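import Mathlib
import Summits.NavierStokesRegularity.NavierStokesRegularity.Theorems.FilamentSkeletonRssStadiumFootBare
import Summits.NavierStokesRegularity.NavierStokesRegularity.Theorems.FilamentSkeletonRssStadiumChordProjection
import Summits.NavierStokesRegularity.NavierStokesRegularity.Theorems.FilamentSkeletonRssStadiumLogBounds

/-!
# Route `FilamentSkeletonRss` · child crux `TangentSkeletonNearStraightL` (stmt-NavierStokesRegularity-23320) · registered line
# `child_tangent_analytic_strip_L` (b0b56c52900dd90a), stub `stub_stripPropagation` — assembly: THE REAL-AXIS FOOT SOURCES OF THE RIGHT CORNER, WITH NUMBERS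

Item R1 (continued) of the quarter-width blueprint (evidence `CORNER-QUARTER-BLUEPRINT-leafhand-15-g0.md` v5 on 23320): the UNSHIFTED part
of the own-filament contour to the right of the descent.  For a target `z = x₀ + iY` in the right output corner region (`0 ≤ Y < hs/4`,
`cc ≤ x₀ < cc + L + hs/4`) and a REAL source `X(x₀ + D)` with `D ≥ hs/2` (inside or outside the stadium), the bare-foot estimate
`Theorems.StadiumFootBare.bare_foot_re_ge_closed_form` (target-leg radius `R₁ = 3hs/4`, `‖F′‖ ≤ 2`) with the chord projection
`c₀ = (1 − Rb²/2)·D` (`Theorems.StadiumChordProjection`) and the numbers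
  `I₁(Y) ≤ I₁(hs/4) ≤ 0.0389·hs`,  `J₁(Y) ≤ J₁(hs/4) ≤ 0.0398·hs`   (monotone in the height; `log(3/2) ≥ 0.4054651`, `Theorems.StadiumLogBounds`)
gives `c₀ − J₁ − Y − I₁ ≥ (7/16 − 0.0398 − 1/4 − 0.0389)·hs > 0`, hence
  `0 < Re(Σᵢ (Fᵢ(z) − X(x₀+D)ᵢ)² + κ·a)`   (`corner_right_foot_re_pos`) — every `Rb ≤ 1/2`, every core value `a > 0`.
Tools: `log_ratio_sub_nonneg`, `legI_closed_mono` / `legJ_closed_mono` (the closed-form `I`/`J` terms of the foot estimate are monotone in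
the height, via their integral representations `Theorems.StadiumLegProfiles.integral_legE_eq / integral_legQE_eq`), `corner_I_le`, `corner_J_le`.
HONEST FRAMING: bookkeeping for a HYPOTHETICAL filament skeleton on the NEGATIVE side of a MODEL route; the stub `stub_stripPropagation` is NOT
closed by this file; nothing here bears on Navier–Stokes regularity or blow-up.  `--supports stmt-NavierStokesRegularity-23320`.
-/

set_option linter.dupNamespace false

noncomputable section

namespace Summit.NavierStokesRegularity.NavierStokesRegularity.Theorems.StadiumCornerRightFoot

open Set MeasureTheory
open scoped InnerProductSpace BigOperators
open Summit.NavierStokesRegularity.NavierStokesRegularity.Theorems.StadiumFootBare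
open Summit.NavierStokesRegularity.NavierStokesRegularity.Theorems.StadiumChordProjection
open Summit.NavierStokesRegularity.NavierStokesRegularity.Theorems.StadiumLogBounds
open Summit.NavierStokesRegularity.NavierStokesRegularity.Theorems.StadiumLegProfiles

/-- `u/R ≤ log(R/(R−u))` for `0 ≤ u < R` (so the second-order real-part profile is nonnegative). [folklore] -/
theorem log_ratio_sub_nonneg {R u : ℝ} (hu : 0 ≤ u) (huR : u < R) : 0 ≤ Real.log (R / (R - u)) - u / R := by
  have hR : 0 < R := lt_of_le_of_lt hu huR
  have hRu : 0 < R - u := by linarith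
  have h1 : Real.log ((R - u) / R) ≤ (R - u) / R - 1 := Real.log_le_sub_one_of_pos (div_pos hRu hR)
  have h2 : Real.log (R / (R - u)) = -Real.log ((R - u) / R) := by
    rw [← Real.log_inv, inv_div]
  have e : (R - u) / R - 1 = -(u / R) := by
    field_simp
    ring
  rw [h2]
  linarith

/-- `0 ≤ log(R/(R−u))` for `0 ≤ u < R`. [folklore] -/
theorem log_ratio_nonneg {R u : ℝ} (hu : 0 ≤ u) (huR : u < R) : 0 ≤ Real.log (R / (R - u)) := by
  have hR : 0 < R := lt_of_le_of_lt hu huR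
  have h := log_ratio_sub_nonneg hu huR
  have : 0 ≤ u / R := div_nonneg hu hR.le
  linarith

/-- Continuity of `u ↦ log(R/(R−u))` on `[0, t]` for `t < R`. [folklore] -/
theorem continuousOn_log_ratio {R t : ℝ} (htR : t < R) :
    ContinuousOn (fun u : ℝ => Real.log (R / (R - u))) (Icc 0 t) := by
  refine ContinuousOn.log (continuousOn_const.div (continuousOn_const.sub continuousOn_id) fun u hu => ?_) fun u hu => ?_
  · have : 0 < R - u := by linarith [hu.2]
    exact this.ne'
  · have h1 : 0 < R - u := by linarith [hu.2]
    have hR : 0 < R := by linarith [hu.1, hu.2]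
    exact (div_pos hR h1).ne'

/-- **The `I`-term of the foot estimate is monotone in the height**: for `0 ≤ M`, `0 ≤ t₁ ≤ t₂ < R`,
`√3·2M(t₁ − (R−t₁)log(R/(R−t₁)) − t₁²/(2R)) ≤ √3·2M(t₂ − (R−t₂)log(R/(R−t₂)) − t₂²/(2R))`. [folklore] -/
theorem legI_closed_mono {M R t₁ t₂ : ℝ} (hM : 0 ≤ M) (ht₁ : 0 ≤ t₁) (h12 : t₁ ≤ t₂) (ht₂ : t₂ < R) :
    √3 * (2 * M * (t₁ - (R - t₁) * Real.log (R / (R - t₁)) - t₁ ^ 2 / (2 * R))) ≤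
      √3 * (2 * M * (t₂ - (R - t₂) * Real.log (R / (R - t₂)) - t₂ ^ 2 / (2 * R))) := by
  have ht₁R : t₁ < R := lt_of_le_of_lt h12 ht₂
  have ht₂0 : 0 ≤ t₂ := ht₁.trans h12
  rw [← integral_legE_eq M ht₁ ht₁R, ← integral_legE_eq M ht₂0 ht₂]
  have hcont : ContinuousOn (fun u : ℝ => √3 * (2 * M * (Real.log (R / (R - u)) - u / R))) (Icc 0 t₂) :=
    continuousOn_const.mul (continuousOn_const.mul ((continuousOn_log_ratio ht₂).sub (continuousOn_id.div_const R)))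
  have hint : ∀ a b, a ∈ Icc (0:ℝ) t₂ → b ∈ Icc (0:ℝ) t₂ →
      IntervalIntegrable (fun u : ℝ => √3 * (2 * M * (Real.log (R / (R - u)) - u / R))) volume a b := by
    intro a b ha hb
    refine (hcont.mono ?_).intervalIntegrable
    exact uIcc_subset_Icc ha hb
  have h0 : (0:ℝ) ∈ Icc (0:ℝ) t₂ := ⟨le_rfl, ht₂0⟩
  have h1 : t₁ ∈ Icc (0:ℝ) t₂ := ⟨ht₁, h12⟩
  have h2 : t₂ ∈ Icc (0:ℝ) t₂ := ⟨ht₂0, le_rfl⟩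
  rw [← intervalIntegral.integral_add_adjacent_intervals (hint 0 t₁ h0 h1) (hint t₁ t₂ h1 h2)]
  have hnn : 0 ≤ ∫ u in t₁..t₂, √3 * (2 * M * (Real.log (R / (R - u)) - u / R)) := by
    refine intervalIntegral.integral_nonneg h12 fun u hu => ?_
    have hu0 : 0 ≤ u := ht₁.trans hu.1
    have huR : u < R := lt_of_le_of_lt hu.2 ht₂
    have := log_ratio_sub_nonneg hu0 huR
    positivity
  linarith

/-- **The `J`-term of the foot estimate is monotone in the height**: for `0 ≤ t₁ ≤ t₂ < R` (any real `M`),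
`6M²·K(R,t₁) ≤ 6M²·K(R,t₂)` with `K(R,t) = 2t − (R−t)ℓ² − 2(R−t)ℓ + (R²−t²)ℓ/(2R) − t/2 − t²/(4R)`, `ℓ = log(R/(R−t))`. [folklore] -/
theorem legJ_closed_mono {M R t₁ t₂ : ℝ} (ht₁ : 0 ≤ t₁) (h12 : t₁ ≤ t₂) (ht₂ : t₂ < R) :
    6 * M ^ 2 * (2 * t₁ - (R - t₁) * Real.log (R / (R - t₁)) ^ 2 - 2 * (R - t₁) * Real.log (R / (R - t₁)) +
        (R ^ 2 - t₁ ^ 2) * Real.log (R / (R - t₁)) / (2 * R) - t₁ / 2 - t₁ ^ 2 / (4 * R)) ≤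
      6 * M ^ 2 * (2 * t₂ - (R - t₂) * Real.log (R / (R - t₂)) ^ 2 - 2 * (R - t₂) * Real.log (R / (R - t₂)) +
        (R ^ 2 - t₂ ^ 2) * Real.log (R / (R - t₂)) / (2 * R) - t₂ / 2 - t₂ ^ 2 / (4 * R)) := by
  have ht₁R : t₁ < R := lt_of_le_of_lt h12 ht₂
  have ht₂0 : 0 ≤ t₂ := ht₁.trans h12
  rw [← integral_legQE_eq M ht₁ ht₁R, ← integral_legQE_eq M ht₂0 ht₂]
  have hcont : ContinuousOn (fun u : ℝ => (√3 * (M * Real.log (R / (R - u)))) *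
      (√3 * (2 * M * (Real.log (R / (R - u)) - u / R)))) (Icc 0 t₂) :=
    (continuousOn_const.mul (continuousOn_const.mul (continuousOn_log_ratio ht₂))).mul
      (continuousOn_const.mul (continuousOn_const.mul ((continuousOn_log_ratio ht₂).sub (continuousOn_id.div_const R))))
  have hint : ∀ a b, a ∈ Icc (0:ℝ) t₂ → b ∈ Icc (0:ℝ) t₂ →
      IntervalIntegrable (fun u : ℝ => (√3 * (M * Real.log (R / (R - u)))) *
        (√3 * (2 * M * (Real.log (R / (R - u)) - u / R)))) volume a b := by
    intro a b ha hb
    refine (hcont.mono ?_).intervalIntegrable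
    exact uIcc_subset_Icc ha hb
  have h0 : (0:ℝ) ∈ Icc (0:ℝ) t₂ := ⟨le_rfl, ht₂0⟩
  have h1 : t₁ ∈ Icc (0:ℝ) t₂ := ⟨ht₁, h12⟩
  have h2 : t₂ ∈ Icc (0:ℝ) t₂ := ⟨ht₂0, le_rfl⟩
  rw [← intervalIntegral.integral_add_adjacent_intervals (hint 0 t₁ h0 h1) (hint t₁ t₂ h1 h2)]
  have hnn : 0 ≤ ∫ u in t₁..t₂, (√3 * (M * Real.log (R / (R - u)))) *
      (√3 * (2 * M * (Real.log (R / (R - u)) - u / R))) := by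
    refine intervalIntegral.integral_nonneg h12 fun u hu => ?_
    have hu0 : 0 ≤ u := ht₁.trans hu.1
    have huR : u < R := lt_of_le_of_lt hu.2 ht₂
    have ha := log_ratio_sub_nonneg hu0 huR
    have hb := log_ratio_nonneg hu0 huR
    -- `(√3·M·ℓ)·(√3·2M·(ℓ − u/R)) = 6M²·ℓ·(ℓ − u/R) ≥ 0`
    have h3 : Real.sqrt 3 * Real.sqrt 3 = 3 := Real.mul_self_sqrt (by norm_num)
    have e : (√3 * (M * Real.log (R / (R - u)))) * (√3 * (2 * M * (Real.log (R / (R - u)) - u / R))) =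
        (Real.sqrt 3 * Real.sqrt 3) * (2 * M ^ 2) * (Real.log (R / (R - u)) * (Real.log (R / (R - u)) - u / R)) := by ring
    rw [e, h3]
    have : 0 ≤ M ^ 2 := sq_nonneg M
    positivity
  linarith

/-- **The `I`-term at the registered corner** (`M = 2`, `R₁ = 3hs/4`, height `≤ hs/4`): `I₁(Y) ≤ 0.0389·hs`. [folklore] -/
theorem corner_I_le {hs Y : ℝ} (hhs : 0 < hs) (hY0 : 0 ≤ Y) (hY : Y ≤ hs / 4) :
    √3 * (2 * 2 * (Y - (3 * hs / 4 - Y) * Real.log (3 * hs / 4 / (3 * hs / 4 - Y)) - Y ^ 2 / (2 * (3 * hs / 4)))) ≤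
      0.0389 * hs := by
  have hmono := legI_closed_mono (M := 2) (R := 3 * hs / 4) (by norm_num) hY0 hY (by linarith)
  refine hmono.trans ?_
  have e : 3 * hs / 4 / (3 * hs / 4 - hs / 4) = 3 / 2 := by
    field_simp
    ring
  rw [e]
  have hl := log_three_halves_bounds.1
  have h3 : Real.sqrt 3 < 1.73206 := by
    rw [Real.sqrt_lt' (by norm_num)]; norm_num
  have h3' : 0 ≤ Real.sqrt 3 := Real.sqrt_nonneg 3
  -- the bracket: `hs/4 − (hs/2)·log(3/2) − hs/24 ≤ 0.0056008·hs`
  have hbr : hs / 4 - (3 * hs / 4 - hs / 4) * Real.log (3 / 2) - (hs / 4) ^ 2 / (2 * (3 * hs / 4)) ≤ 0.0056008 * hs := by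
    have e2 : (hs / 4) ^ 2 / (2 * (3 * hs / 4)) = hs / 24 := by
      field_simp
      ring
    rw [e2]
    nlinarith
  have hbr0 : 0 ≤ hs / 4 - (3 * hs / 4 - hs / 4) * Real.log (3 / 2) - (hs / 4) ^ 2 / (2 * (3 * hs / 4)) := by
    have hl2 := log_three_halves_bounds.2
    have e2 : (hs / 4) ^ 2 / (2 * (3 * hs / 4)) = hs / 24 := by
      field_simp
      ring
    rw [e2]
    nlinarith
  calc √3 * (2 * 2 * (hs / 4 - (3 * hs / 4 - hs / 4) * Real.log (3 / 2) - (hs / 4) ^ 2 / (2 * (3 * hs / 4))))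
      ≤ 1.73206 * (2 * 2 * (0.0056008 * hs)) := by
        have h4 : 0 ≤ 2 * 2 * (hs / 4 - (3 * hs / 4 - hs / 4) * Real.log (3 / 2) - (hs / 4) ^ 2 / (2 * (3 * hs / 4))) := by
          positivity
        exact mul_le_mul h3.le (by linarith) h4 (by norm_num)
    _ ≤ 0.0389 * hs := by nlinarith

/-- **The `J`-term at the registered corner** (`M = 2`, `R₁ = 3hs/4`, height `≤ hs/4`): `J₁(Y) ≤ 0.0398·hs`. [folklore] -/
theorem corner_J_le {hs Y : ℝ} (hhs : 0 < hs) (hY0 : 0 ≤ Y) (hY : Y ≤ hs / 4) :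
    6 * (2:ℝ) ^ 2 * (2 * Y - (3 * hs / 4 - Y) * Real.log (3 * hs / 4 / (3 * hs / 4 - Y)) ^ 2 -
        2 * (3 * hs / 4 - Y) * Real.log (3 * hs / 4 / (3 * hs / 4 - Y)) +
        ((3 * hs / 4) ^ 2 - Y ^ 2) * Real.log (3 * hs / 4 / (3 * hs / 4 - Y)) / (2 * (3 * hs / 4)) - Y / 2 -
        Y ^ 2 / (4 * (3 * hs / 4))) ≤ 0.0398 * hs := by
  have hmono := legJ_closed_mono (M := 2) (R := 3 * hs / 4) hY0 hY (by linarith)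
  refine hmono.trans ?_
  have e : 3 * hs / 4 / (3 * hs / 4 - hs / 4) = 3 / 2 := by
    field_simp
    ring
  rw [e]
  have hl := log_three_halves_bounds.1
  have hl2 := log_three_halves_bounds.2
  set ℓ := Real.log (3 / 2) with hℓ
  -- the bracket equals `hs·(17/48 − ℓ²/2 − 2ℓ/3)`
  have e2 : 2 * (hs / 4) - (3 * hs / 4 - hs / 4) * ℓ ^ 2 - 2 * (3 * hs / 4 - hs / 4) * ℓ +
      ((3 * hs / 4) ^ 2 - (hs / 4) ^ 2) * ℓ / (2 * (3 * hs / 4)) - hs / 4 / 2 - (hs / 4) ^ 2 / (4 * (3 * hs / 4)) =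
      hs * (17 / 48 - ℓ ^ 2 / 2 - 2 * ℓ / 3) := by
    field_simp
    ring
  rw [e2]
  have hq : 17 / 48 - ℓ ^ 2 / 2 - 2 * ℓ / 3 ≤ 0.0016557 := by nlinarith
  nlinarith

/-- **The real-axis foot sources of the right corner, with numbers.**  Stadium `S = {|Im| < hs, |Re − cc| < L + hs}`, `F` holomorphic on
`S` with `‖F′‖ ≤ 2`, `Σ (F′)ᵢ² = 1`, `F = cplx ∘ X` on the real trace, `X` of class `C¹` with unit speed and tangent oscillation
`≤ Rb ≤ 1/2`; a target `z = x₀ + iY` of the right output corner region (`0 ≤ Y < hs/4`, `cc ≤ x₀ < cc + L + hs/4`) and a REAL source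
`X(x₀ + D)` with `D ≥ hs/2` (anywhere on the real axis to the right of the foot of the descent); core term `0 < κ`, `0 < a`.  Then
`0 < Re(Σᵢ (Fᵢ(z) − X(x₀+D)ᵢ)² + κ·a)`. [folklore] -/
theorem corner_right_foot_re_pos {hs L cc : ℝ} {F : ℂ → (Fin 3 → ℂ)}
    (hF : DifferentiableOn ℂ F {z : ℂ | |z.im| < hs ∧ |z.re - cc| < L + hs})
    (hM : ∀ z ∈ {z : ℂ | |z.im| < hs ∧ |z.re - cc| < L + hs}, ‖deriv F z‖ ≤ 2)
    (hunit : ∀ w ∈ {z : ℂ | |z.im| < hs ∧ |z.re - cc| < L + hs}, ∑ i, (deriv F w i) ^ 2 = 1)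
    {X : ℝ → EuclideanSpace ℝ (Fin 3)} (hX : ContDiff ℝ 1 X) (hXu : ∀ τ, ‖deriv X τ‖ = 1)
    {Rb : ℝ} (hRb0 : 0 ≤ Rb) (hRb : Rb ≤ 1 / 2) (hosc : ∀ τ σ, ‖deriv X τ - deriv X σ‖ ≤ Rb)
    (hFX : ∀ r : ℝ, (r : ℂ) ∈ {z : ℂ | |z.im| < hs ∧ |z.re - cc| < L + hs} →
      F r = fun i => ((⟪X r, EuclideanSpace.single i (1:ℝ)⟫_ℝ : ℝ) : ℂ))
    (hhs : 0 < hs) {x₀ Y D : ℝ} (hY0 : 0 ≤ Y) (hY : Y < hs / 4) (hx₀ : x₀ < cc + L + hs / 4) (hx₀cc : cc ≤ x₀)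
    (hD : hs / 2 ≤ D) {κ a : ℝ} (hκ : 0 < κ) (ha : 0 < a) :
    0 < ((∑ i, (F ((x₀ : ℂ) + (Y : ℂ) * Complex.I) i - ((⟪X (x₀ + D), EuclideanSpace.single i (1:ℝ)⟫_ℝ : ℝ) : ℂ)) ^ 2) +
      ((κ * a : ℝ) : ℂ)).re := by
  have hXd : Differentiable ℝ X := hX.differentiable (by norm_num)
  -- the target leg radius `R₁ = 3hs/4`
  have hR₁Y : Y < 3 * hs / 4 := by linarith
  have hR₁hs : 3 * hs / 4 < hs := by linarith
  have hR₁end : |x₀ - cc| + 3 * hs / 4 < L + hs := by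
    rw [abs_of_nonneg (by linarith)]; linarith
  -- the chord projection `c₀ = (1 − Rb²/2)·D ≥ 7hs/16`
  have hc₀ := chord_proj_coords_ge hX hXu hosc (x₁ := x₀) (x₂ := x₀ + D) (by linarith)
  have hc₀' : 7 / 16 * hs ≤ (1 - Rb ^ 2 / 2) * (x₀ + D - x₀) := by
    have e : x₀ + D - x₀ = D := by ring
    rw [e]
    have h1 : 7 / 8 ≤ 1 - Rb ^ 2 / 2 := by nlinarith
    nlinarith
  -- the numbers
  have hI := corner_I_le hhs hY0 hY.le
  have hJ := corner_J_le hhs hY0 hY.le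
  have hI0 : 0 ≤ √3 * (2 * 2 * (Y - (3 * hs / 4 - Y) * Real.log (3 * hs / 4 / (3 * hs / 4 - Y)) - Y ^ 2 / (2 * (3 * hs / 4)))) := by
    have h := legI_closed_mono (M := 2) (R := 3 * hs / 4) (t₁ := 0) (t₂ := Y) (by norm_num) le_rfl hY0 hR₁Y
    have e : √3 * (2 * 2 * (0 - (3 * hs / 4 - 0) * Real.log (3 * hs / 4 / (3 * hs / 4 - 0)) - 0 ^ 2 / (2 * (3 * hs / 4)))) = 0 := by
      rw [sub_zero, div_self (by positivity : (3 * hs / 4) ≠ 0), Real.log_one]; ring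
    rw [e] at h
    exact h
  -- atomise the three closed forms
  generalize hCv : (1 - Rb ^ 2 / 2) * (x₀ + D - x₀) = Cv at hc₀ hc₀'
  generalize hJv : 6 * (2:ℝ) ^ 2 * (2 * Y - (3 * hs / 4 - Y) * Real.log (3 * hs / 4 / (3 * hs / 4 - Y)) ^ 2 -
        2 * (3 * hs / 4 - Y) * Real.log (3 * hs / 4 / (3 * hs / 4 - Y)) +
        ((3 * hs / 4) ^ 2 - Y ^ 2) * Real.log (3 * hs / 4 / (3 * hs / 4 - Y)) / (2 * (3 * hs / 4)) - Y / 2 -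
        Y ^ 2 / (4 * (3 * hs / 4))) = Jv at hJ
  generalize hIv : √3 * (2 * 2 * (Y - (3 * hs / 4 - Y) * Real.log (3 * hs / 4 / (3 * hs / 4 - Y)) -
      Y ^ 2 / (2 * (3 * hs / 4)))) = Iv at hI hI0
  have ha' : 0 ≤ Cv - Jv := by linarith
  have h := bare_foot_re_ge_closed_form (M := 2) hF hM hunit hXd hXu hosc hFX hhs hY0 hR₁Y hR₁hs hR₁end hc₀
    (by rw [hJv]; exact ha')
  rw [hJv, hIv] at h
  -- difference of squares with a positive gap
  have hB0 : 0 ≤ Y + Iv := by linarith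
  have hgap : Y + Iv < Cv - Jv := by linarith
  have hsq : 0 < (Cv - Jv) ^ 2 - (Y + Iv) ^ 2 := by nlinarith
  rw [Complex.add_re, Complex.ofReal_re]
  have hκa : 0 < κ * a := mul_pos hκ ha
  linarith

end Summit.NavierStokesRegularity.NavierStokesRegularity.Theorems.StadiumCornerRightFoot

end
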